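import Literature.Geometry.Riemannian.MeanConvexContractibleDiffeoBall
import HarnessLib

/-!
# "PSC with mean-convex boundary" is a diffeomorphism invariant of manifolds with boundary
(topic `Geometry/Riemannian`)

Fifth proof file of the named fact `Literature.Geometry.Riemannian.Sweeney2026_pscMeanConvex`
(`MeanConvexContractible.lean`; Sweeney 2026, Prop. 1.2). The conclusion of the fact for a compact
`(n+1)`-manifold with boundary `X` and a boundary datum `bX` — a Riemannian metric with Levi-Civita
connection and positive scalar curvature for which `bX.incl` is a spacelike immersion with a smooth
outward unit normal of positive mean curvature — is transported along any diffeomorphism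
`Ψ : X ≅ X'` of manifolds with boundary (`pscMeanConvex_of_diffeomorph`): if `X'` satisfies it
relative to the pushed-forward boundary datum `(B, Ψ ∘ incl)`
(`boundaryDataPushforward`, `MeanConvexContractibleDiffeoBall.lean`), then `X` satisfies it
relative to `bX`, with the pulled-back metric `Ψ^* g` (naturality of the scalar and mean
curvatures, `scalarCurvature_comap`, `meanCurvature_comap` — `CurvatureNaturality.lean`,
`HypersurfaceNaturality.lean`), the pulled-back normal `(dΨ)⁻¹ ν = d(Ψ⁻¹) ν`
(`contMDiffAt_inverse_mfderiv_apply`), which stays outward because the differential of a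
diffeomorphism at a boundary point maps outward vectors to outward vectors
(`mfderiv_diffeomorph_apply_zero_neg`). So every topological input of Prop. 1.2 ("`X` is
diffeomorphic to …") may be fed in up to diffeomorphism. PROVED; no definitions, no named facts.

## References

* P. Sweeney Jr., *Positive curvature conditions on contractible manifolds*, Math. Ann. (2026)
  = arXiv:2507.15719, Prop. 1.2. [Sweeney2026]
* B. O'Neill, *Semi-Riemannian geometry* (1983), Ch. 3, Prop. 3.59 (isometries preserve
  curvature); Ch. 4, Lemma 4.4 ff. [ONeill1983]
-/

noncomputable section

open Bundle Set Function Metric Module Filter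
open scoped Manifold ContDiff Topology RealInnerProductSpace

namespace Literature.Geometry.Riemannian

open Lorentzian Lorentzian.PseudoRiemannianMetric

/-! ### The conclusion of the fact is invariant under diffeomorphisms of manifolds with boundary -/

section ConclusionTransport

open Literature.Topology.FourManifolds

variable {n : ℕ} {X : Type} [TopologicalSpace X] [ChartedSpace (EuclideanHalfSpace (n + 1)) X]
  [IsManifold (𝓡∂ (n + 1)) ∞ X] {X' : Type} [TopologicalSpace X']
  [ChartedSpace (EuclideanHalfSpace (n + 1)) X'] [IsManifold (𝓡∂ (n + 1)) ∞ X']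

variable (n) in
/-- **Diffeomorphism invariance of "PSC with mean-convex boundary".** If `Ψ : X ≅ X'` is a
diffeomorphism of `(n+1)`-manifolds with boundary and `X'` carries, relative to the pushed-forward
boundary datum `bX_* = (B, Ψ ∘ incl)` (`boundaryDataPushforward`), a Riemannian metric with
Levi-Civita connection and positive scalar curvature whose boundary is a spacelike immersion with a
smooth outward unit normal of positive mean curvature — the conclusion of
`Literature.Geometry.Riemannian.Sweeney2026_pscMeanConvex` — then so does `X` relative to `bX`: pull
the metric back along `Ψ` (naturality of the scalar curvature and of the mean curvature,
`scalarCurvature_comap`, `meanCurvature_comap`), pull the normal back by `dΨ`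
(`contMDiffAt_inverse_mfderiv_apply`); it stays outward because `d(Ψ⁻¹)` maps outward vectors to
outward vectors (`mfderiv_diffeomorph_apply_zero_neg`). [cite: Sweeney2026, Prop. 1.2] -/
theorem pscMeanConvex_of_diffeomorph (bX : BoundaryData (𝓡∂ (n + 1)) X (𝓡 n))
    (Ψ : X ≃ₘ⟮𝓡∂ (n + 1), 𝓡∂ (n + 1)⟯ X')
    (h : ∃ g : PseudoRiemannianMetric (𝓡∂ (n + 1)) ∞ (EuclideanSpace ℝ (Fin (n + 1)))
        (TangentSpace (𝓡∂ (n + 1)) : X' → Type _),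
      ∃ _ : g.HasLeviCivita, ∃ hf : g.IsSpacelikeImmersion (𝓡 n) (boundaryDataPushforward bX Ψ).incl,
      ∃ ν : NormalField (𝓡∂ (n + 1)) (boundaryDataPushforward bX Ψ).incl,
        g.IsRiemannian ∧ (∀ x, 0 < g.scalarCurvature x) ∧
        g.IsUnitNormal (𝓡 n) (boundaryDataPushforward bX Ψ).incl ν 1 ∧
        ContMDiff (𝓡 n) (𝓡∂ (n + 1)).tangent ∞
          (fun z ↦ (TotalSpace.mk' (EuclideanSpace ℝ (Fin (n + 1)))
            ((boundaryDataPushforward bX Ψ).incl z) (ν z) : TangentBundle (𝓡∂ (n + 1)) X')) ∧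
        (∀ z, (show EuclideanSpace ℝ (Fin (n + 1)) from ν z) 0 < 0) ∧
        ∀ z, 0 < g.meanCurvature (boundaryDataPushforward bX Ψ).incl
          PseudoRiemannianMetric.contMDiff_pullbackBilin_holds hf ν z) :
    ∃ g : PseudoRiemannianMetric (𝓡∂ (n + 1)) ∞ (EuclideanSpace ℝ (Fin (n + 1)))
        (TangentSpace (𝓡∂ (n + 1)) : X → Type _),
    ∃ _ : g.HasLeviCivita, ∃ hf : g.IsSpacelikeImmersion (𝓡 n) bX.incl,
    ∃ ν : NormalField (𝓡∂ (n + 1)) bX.incl,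
      g.IsRiemannian ∧ (∀ x, 0 < g.scalarCurvature x) ∧ g.IsUnitNormal (𝓡 n) bX.incl ν 1 ∧
      ContMDiff (𝓡 n) (𝓡∂ (n + 1)).tangent ∞
        (fun z ↦ (TotalSpace.mk' (EuclideanSpace ℝ (Fin (n + 1))) (bX.incl z) (ν z) :
          TangentBundle (𝓡∂ (n + 1)) X)) ∧
      (∀ z, (show EuclideanSpace ℝ (Fin (n + 1)) from ν z) 0 < 0) ∧
      ∀ z, 0 < g.meanCurvature bX.incl
        PseudoRiemannianMetric.contMDiff_pullbackBilin_holds hf ν z := by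
  obtain ⟨gM, hLCM, hΦb₀, νM₀, hgM, hS, hν₀, hνs₀, hout₀, hH₀⟩ := h
  -- read the data over `bX.carrier` (the push-forward has the same carrier, `incl_* = Ψ ∘ incl`)
  have hΦb : gM.IsSpacelikeImmersion (𝓡 n) (Ψ ∘ bX.incl) := hΦb₀
  set νM : NormalField (𝓡∂ (n + 1)) (Ψ ∘ bX.incl) := νM₀ with hνM_def
  have hν : gM.IsUnitNormal (𝓡 n) (Ψ ∘ bX.incl) νM 1 := hν₀
  have hνs : ContMDiff (𝓡 n) (𝓡∂ (n + 1)).tangent ∞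
      (fun z ↦ (TotalSpace.mk' (EuclideanSpace ℝ (Fin (n + 1))) (Ψ (bX.incl z)) (νM z) :
        TangentBundle (𝓡∂ (n + 1)) X')) := hνs₀
  have hout : ∀ z, (show EuclideanSpace ℝ (Fin (n + 1)) from νM z) 0 < 0 := hout₀
  have hH : ∀ z, 0 < gM.meanCurvature (Ψ ∘ bX.incl)
      PseudoRiemannianMetric.contMDiff_pullbackBilin_holds hΦb νM z := hH₀
  have hdim : Module.finrank ℝ (EuclideanSpace ℝ (Fin (n + 1))) =
      Module.finrank ℝ (EuclideanSpace ℝ (Fin (n + 1))) := rfl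
  have hΦ : ContMDiff (𝓡∂ (n + 1)) (𝓡∂ (n + 1)) ∞ Ψ := Ψ.contMDiff
  have hΦ1 : ContMDiff (𝓡∂ (n + 1)) (𝓡∂ (n + 1)) (∞ + 1) Ψ := hΦ
  have hΦ' : ∀ x, Injective (mfderiv (𝓡∂ (n + 1)) (𝓡∂ (n + 1)) Ψ x) := fun x ↦
    (Ψ.mfderivToContinuousLinearEquiv (by simp) x).injective
  have hpb : PseudoRiemannianMetric.contMDiff_pullbackBilin (𝓡∂ (n + 1)) X' (𝓡∂ (n + 1)) X ∞ :=
    PseudoRiemannianMetric.contMDiff_pullbackBilin_holds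
  haveI hLC : (gM.comap hpb Ψ hΦ1 hΦ' hdim).HasLeviCivita := (gM.comap hpb Ψ hΦ1 hΦ' hdim).hasLeviCivita
  have hinv : ∀ x, (mfderiv (𝓡∂ (n + 1)) (𝓡∂ (n + 1)) Ψ x).IsInvertible := fun x ↦
    PseudoRiemannianMetric.isInvertible_mfderiv_of_injective hdim (hΦ' x)
  have hincl : ContMDiff (𝓡 n) (𝓡∂ (n + 1)) ∞ bX.incl := bX.isSmoothEmbedding.contMDiff
  have hincl_inj : ∀ z, Injective (mfderiv (𝓡 n) (𝓡∂ (n + 1)) bX.incl z) := fun z ↦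
    Literature.Topology.FourManifolds.Manifold.IsImmersionAt.mfderiv_injective
      (bX.isSmoothEmbedding.isImmersion.isImmersionAt z) (by simp)
  have hincl_d : ∀ z, MDifferentiableAt (𝓡 n) (𝓡∂ (n + 1)) bX.incl z := fun z ↦
    (hincl z).mdifferentiableAt (by simp)
  have hΦd : ∀ x, MDifferentiableAt (𝓡∂ (n + 1)) (𝓡∂ (n + 1)) Ψ x := fun x ↦
    (hΦ x).mdifferentiableAt (by simp)
  have hchain : ∀ z (w : TangentSpace (𝓡 n) z),
      mfderiv (𝓡 n) (𝓡∂ (n + 1)) (Ψ ∘ bX.incl) z w =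
        mfderiv (𝓡∂ (n + 1)) (𝓡∂ (n + 1)) Ψ (bX.incl z)
          (mfderiv (𝓡 n) (𝓡∂ (n + 1)) bX.incl z w) := fun z w ↦ by
    rw [mfderiv_comp z (hΦd _) (hincl_d z)]
    rfl
  have hval : ∀ x (v w : TangentSpace (𝓡∂ (n + 1)) x), (gM.comap hpb Ψ hΦ1 hΦ' hdim).val x v w =
      gM.val (Ψ x) (mfderiv (𝓡∂ (n + 1)) (𝓡∂ (n + 1)) Ψ x v)
        (mfderiv (𝓡∂ (n + 1)) (𝓡∂ (n + 1)) Ψ x w) := fun x v w ↦ rfl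
  -- (1) Riemannian
  have hriem : (gM.comap hpb Ψ hΦ1 hΦ' hdim).IsRiemannian := fun x v hv ↦ by
    rw [hval]
    exact hgM _ _ fun h0 ↦ hv (hΦ' x (h0.trans (map_zero _).symm))
  -- (2) spacelike boundary
  have hf : (gM.comap hpb Ψ hΦ1 hΦ' hdim).IsSpacelikeImmersion (𝓡 n) bX.incl := by
    refine ⟨hincl, fun z v hv ↦ ?_⟩
    rw [PseudoRiemannianMetric.inducedBilin_apply, hval]
    refine hgM _ _ fun h0 ↦ hv (hincl_inj z ?_)
    rw [map_zero]
    exact hΦ' _ (h0.trans (map_zero _).symm)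
  -- (3) the pulled-back normal
  set ν : NormalField (𝓡∂ (n + 1)) bX.incl := fun z ↦
    (mfderiv (𝓡∂ (n + 1)) (𝓡∂ (n + 1)) Ψ (bX.incl z)).inverse (νM z) with hν_def
  have hΦν : ∀ z, mfderiv (𝓡∂ (n + 1)) (𝓡∂ (n + 1)) Ψ (bX.incl z) (ν z) = νM z := fun z ↦
    (hinv _).self_apply_inverse _
  have hunit : (gM.comap hpb Ψ hΦ1 hΦ' hdim).IsUnitNormal (𝓡 n) bX.incl ν 1 := by
    refine ⟨fun z v ↦ ?_, fun z ↦ ?_⟩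
    · rw [hval, hΦν, ← hchain]
      exact hν.1 z v
    · rw [hval, hΦν]
      exact hν.2 z
  have hνs' : ContMDiff (𝓡 n) (𝓡∂ (n + 1)).tangent ∞
      (fun z ↦ (TotalSpace.mk' (EuclideanSpace ℝ (Fin (n + 1))) (bX.incl z) (ν z) :
        TangentBundle (𝓡∂ (n + 1)) X)) := fun z ↦
    contMDiffAt_inverse_mfderiv_apply hΦ hinv (hincl z) (hνs z)
  -- (4) mean curvature by naturality
  have hmean : ∀ z, (gM.comap hpb Ψ hΦ1 hΦ' hdim).meanCurvature bX.incl
      PseudoRiemannianMetric.contMDiff_pullbackBilin_holds hf ν z =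
        gM.meanCurvature (Ψ ∘ bX.incl) PseudoRiemannianMetric.contMDiff_pullbackBilin_holds
          hΦb νM z := fun z ↦ by
    have h := gM.meanCurvature_comap hpb hΦ1 hΦ' hdim
      PseudoRiemannianMetric.contMDiff_pullbackBilin_holds
      PseudoRiemannianMetric.contMDiff_pullbackBilin_holds hf hΦb (ν := ν) (y := z)
      BoundarylessManifold.isInteriorPoint ((hνs' z).mdifferentiableAt (by simp))
    rw [h]
    congr 1
    funext w
    exact hΦν w
  -- (5) outwardness: `ν = d(Ψ⁻¹) νM`
  have hνsymm : ∀ z, ν z = mfderiv (𝓡∂ (n + 1)) (𝓡∂ (n + 1)) Ψ.symm (Ψ (bX.incl z)) (νM z) :=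
    fun z ↦ by
    have key : mfderiv (𝓡∂ (n + 1)) (𝓡∂ (n + 1)) Ψ (bX.incl z)
        (mfderiv (𝓡∂ (n + 1)) (𝓡∂ (n + 1)) Ψ.symm (Ψ (bX.incl z)) (νM z)) = νM z := by
      have hBB := congrArg (fun f : TangentSpace (𝓡∂ (n + 1)) (Ψ (bX.incl z)) →L[ℝ]
        TangentSpace (𝓡∂ (n + 1)) (Ψ (bX.incl z)) ↦ f (νM z))
          (mfderiv_diffeomorph_comp_mfderiv_symm Ψ (bX.incl z))
      simp only [ContinuousLinearMap.comp_apply, ContinuousLinearMap.id_apply] at hBB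
      exact hBB
    show (mfderiv (𝓡∂ (n + 1)) (𝓡∂ (n + 1)) Ψ (bX.incl z)).inverse (νM z) = _
    conv_lhs => rw [← key]
    exact (hinv _).inverse_apply_self _
  have hout' : ∀ z, (show EuclideanSpace ℝ (Fin (n + 1)) from ν z) 0 < 0 := fun z ↦ by
    have hzmem : Ψ (bX.incl z) ∈ (𝓡∂ (n + 1)).boundary X' :=
      (boundaryDataPushforward bX Ψ).incl_mem_boundary z
    have h := mfderiv_diffeomorph_apply_zero_neg Ψ.symm hzmem (hout z)
    rw [← hνsymm z] at h
    exact h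
  refine ⟨gM.comap hpb Ψ hΦ1 hΦ' hdim, hLC, hf, ν, hriem, fun x ↦ ?_, hunit, hνs', hout', fun z ↦ ?_⟩
  · rw [gM.scalarCurvature_comap hpb hΦ1 hΦ' hdim x]
    exact hS _
  · rw [hmean z]
    exact hH z

end ConclusionTransport

end Literature.Geometry.Riemannian

end
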